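import Summits.HodgeConjecture.CorCM.MultiFieldWeilThreefoldSurfaceBlocks
import Summits.HodgeConjecture.CorCM.MultiFieldWeilAnyTwoSimpleDimLeThreeAnyCurves
import HarnessLib

/-!
# MULTI-FIELD WEIL ENGINE — AT MOST TWO THREEFOLDS, AT MOST TWO SURFACES, ANY CURVES: every product of copies of a family of simple CM abelian varieties of
# dimension `≤ 3` with at most two threefold slots and at most two surface slots satisfies the Hodge conjecture, given ONLY Markman's fourfold theorem

Cell `pub-hodgecm2` (COR-CM), seat b30 gen 35 (2026-08-25); count-neutral own lane MULTI-FIELD WEIL ENGINE (stem `MultiFieldWeil*`), sequel of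
`CorCM/MultiFieldWeilThreefoldSurfaceBlocks.lean` (THE THREEFOLD BLOCK SPLITS OFF THE SURFACE BLOCK, unconditional).  Theorems only; no definition, no named fact, no
`sorry`.  HONEST FRAMING: §2 is UNCONDITIONAL; §1 and §3 are conditional on the displayed Markman fourfold binder only; `HC_CM` is NOT proved and not asserted — this is
a statement about a NAMED CLASS of CM abelian varieties.

THE STATEMENT (§3, **`hodgeConjectureFor_prod_of_atMostTwo_threefolds_atMostTwo_surfaces_of_markman`**).  `A_i ⊨ (K_i; Φ_i)` (`i ∈ I`, finite; ONE index type, the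
fields a family `K : I → Type`) SIMPLE complex abelian varieties of CM type of dimension `≤ 3` such that at most two SLOTS carry a sextic field and at most two a quartic
field (among any three sextic slots two coincide; likewise quartic) — any number of quadratic slots (CM elliptic curves, isogenous or not), nothing assumed on any field.
Then for every `π : Fin N → I` the Hodge conjecture holds for `⨁_j A_{π j}` — every `T₀^a × T₁^b × S₀^c × S₁^d × ∏_e E_e^{n_e}` — GIVEN ONLY
`Markman2025_weilClasses_algebraic_abelianFourfold`; with the dominated form.  The gen-34 capstone had «at most two slots of dimension `≥ 2`»; seat b16's dihedral
surface triple (obstruction (iii′)) shows that «at most two surface slots» cannot be dropped without a new input.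

PROOF.  The previous file splits `Hg` over the two blocks {threefolds, curves through their fields} ∣ {surfaces, other curves} and glues the Hodge conjecture along the
split.  §1 THE THREEFOLD BLOCK: a product of copies of members none of which is a surface, all sextic slots among `t₀, t₁`, is — slot by slot, definitionally — a product
of copies of the family `Sum.elim ![A_{t₀}, A_{t₁}] (curves)`, and gen 34's roof «any two simple CM threefolds × any finite family of CM elliptic curves»
(`hodgeConjectureFor_prod_two_simpleThreefolds_anyCurves_of_markman`, Markman 4) applies.  §2 THE SURFACE BLOCK: likewise with no threefold among the members and all
quartic slots among `s₀, s₁` (of degree `2` or `4`), by gen 34's UNCONDITIONAL `hodgeConjectureFor_prod_two_simple_dim_le_two_anyCurves` (seat p2's census of curves and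
simple surfaces).  §3 assembles: both blocks met ↦ the gluing; one block only ↦ §1 or §2 directly; the empty product is zero-dimensional.

[cite: MoonenZarhin1999LowDim, Thm. (0.1), Thm. (0.2), §3 (3.1), Cor. (3.9), §5 (5.2)] [cite: Markman2025SurveySecant, Thm. 1.2] [cite: Gordon1999HodgeAVSurvey, §3 Theorem (proof), 7.4–7.7, 10.10]
[cite: Shimura1998, §8.2 Prop. 26, §8.4 (2)] [cite: MumfordAV1970, §19 Thm. 1 and p. 169]

## References
* [MoonenZarhin1999LowDim] B. Moonen, Yu. Zarhin, Math. Ann. 315 (1999) 711–733.  [Markman2025SurveySecant] E. Markman, arXiv:2509.23403, Thm. 1.2.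
  [Gordon1999HodgeAVSurvey] B. B. Gordon, *A survey of the Hodge conjecture for abelian varieties*, §3, 7.4–7.7, 10.10.  [Shimura1998] G. Shimura, *Abelian varieties with
  complex multiplication and modular functions*, §8.2, §8.4.  [MumfordAV1970] D. Mumford, *Abelian Varieties*, §19.
-/

noncomputable section

open CategoryTheory CategoryTheory.Limits NumberField IntermediateField

namespace Summit.HodgeConjecture.CorCM.MultiFieldWeil

open Literature.AlgebraicGeometry Literature.AlgebraicGeometry.Motives Literature.AlgebraicGeometry.HodgeTheory
open Literature.AlgebraicGeometry.ComplexMultiplication (IsCMTypeRealisation)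
open Literature.AlgebraicTopology.SingularHomology
open Literature.NumberTheory.ComplexMultiplication
open Literature.AlgebraicGeometry.Pohlmann1968

open scoped Classical

section Family

variable {I : Type} [Fintype I] {K : I → Type} [fK : ∀ i, Field (K i)] [nK : ∀ i, NumberField (K i)] [cK : ∀ i, IsCMField (K i)]
  {Φ : ∀ i, CMType (K i)} {A : I → AbelianVariety ℂ} {ι : ∀ i, 𝓞 (K i) →+* End (A i)} {θ : ∀ i, K i →+* Module.End ℂ (complexBetti (A i).X 1)}

omit [Fintype I] cK in
/-- The CM field of a realisation of dimension `≤ 3` has degree `2`, `4` or `6`. [cite: Shimura1998, §5.2] -/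
private theorem finrank_eq_or_of_dim_le_three₃₅' (hA : ∀ i, IsCMTypeRealisation (Φ i) (A i) (ι i) (θ i)) {i : I} (h3 : (A i).dim ≤ 3) :
    Module.finrank ℚ (K i) = 2 ∨ Module.finrank ℚ (K i) = 4 ∨ Module.finrank ℚ (K i) = 6 := by
  have h := finrank_eq_two_mul_dim_of_isCMTypeRealisation (hA i)
  have hpos : 0 < Module.finrank ℚ (K i) := Module.finrank_pos
  interval_cases hd : (A i).dim <;> omega

omit [Fintype I] cK in
/-- An embedding of number fields `K_i ↪ K_t` makes `[K_i : ℚ]` divide `[K_t : ℚ]`. [cite: Shimura1998, §8.1] -/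
private theorem finrank_dvd_of_ringHom₃₅' {i t : I} (g : K i →+* K t) : Module.finrank ℚ (K i) ∣ Module.finrank ℚ (K t) := by
  have h1 : Module.finrank ℚ ↥g.toRatAlgHom.fieldRange = Module.finrank ℚ (K i) :=
    ((AlgEquiv.ofInjectiveField g.toRatAlgHom).toLinearEquiv.finrank_eq).symm
  rw [← h1, ← IntermediateField.finrank_top' (F := ℚ) (E := K t)]
  exact IntermediateField.finrank_dvd_of_le_right le_top

/-- The empty product of abelian varieties satisfies the Hodge conjecture (it is zero-dimensional, `B = D` trivially). [cite: MumfordAV1970, §19] -/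
private theorem hodgeConjectureFor_biproduct_fin_zero₃₅ (f : Fin 0 → AbelianVariety ℂ) : HodgeConjectureFor (⨁ f).dim (⨁ f).X :=
  hodgeConjectureFor_of_isDivisorGenerated _ (isDivisorGenerated_of_dim_eq_zero _ (dim_biproduct_fin_zero f))

/-! ## §1 The surface block: at most two slots of dimension `≤ 2` and curves — unconditional -/

/-- **THE SURFACE BLOCK (unconditional).**  `A_i ⊨ (K_i; Φ_i)` simple; `s₀, s₁` slots with fields of degree `2` or `4` (CM elliptic curves or simple CM surfaces); a
product of copies `⨁_l A_{ρ l}` every member of which is a CM elliptic curve or one of `A_{s₀}, A_{s₁}`.  Then the Hodge conjecture holds for it — slot by slot it is a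
product of copies of `Sum.elim ![A_{s₀}, A_{s₁}] (curves)`, and gen 34's unconditional `hodgeConjectureFor_prod_two_simple_dim_le_two_anyCurves` (seat p2's census of
curves and simple surfaces) applies. [cite: MoonenZarhin1999LowDim, §3 (3.1), Cor. (3.9)] [cite: Gordon1999HodgeAVSurvey, §3 Theorem (proof), 7.5 and 10.10] -/
theorem hodgeConjectureFor_prod_surfaceBlock (hA : ∀ i, IsCMTypeRealisation (Φ i) (A i) (ι i) (θ i)) (hS : ∀ i, (A i).IsSimple) {s₀ s₁ : I}
    (hd₀ : Module.finrank ℚ (K s₀) = 2 ∨ Module.finrank ℚ (K s₀) = 4) (hd₁ : Module.finrank ℚ (K s₁) = 2 ∨ Module.finrank ℚ (K s₁) = 4) {M : ℕ} (ρ : Fin M → I)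
    (hρ : ∀ l, Module.finrank ℚ (K (ρ l)) = 2 ∨ ρ l = s₀ ∨ ρ l = s₁) : HodgeConjectureFor (⨁ fun l => A (ρ l)).dim (⨁ fun l => A (ρ l)).X := by
  -- the curve slots and the slot map onto `Fin 2 ⊕ Ic`
  let Ic : Type := {i : I // Module.finrank ℚ (K i) = 2}
  let σ : I → Fin 2 ⊕ Ic := fun i => if h : Module.finrank ℚ (K i) = 2 then Sum.inr ⟨i, h⟩ else if i = s₀ then Sum.inl 0 else Sum.inl 1
  have hσ : ∀ i, (Module.finrank ℚ (K i) = 2 ∨ i = s₀ ∨ i = s₁) → A i = (Sum.elim ![A s₀, A s₁] (fun c : Ic => A c.1) (σ i) : AbelianVariety ℂ) := by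
    intro i hi
    by_cases h : Module.finrank ℚ (K i) = 2
    · simp only [σ, dif_pos h, Sum.elim_inr]
    · rcases hi with h2 | rfl | rfl
      · exact absurd h2 h
      · simp only [σ, dif_neg h]
        rfl
      · by_cases h' : i = s₀
        · simp only [σ, dif_neg h, if_pos h', Sum.elim_inl]
          rw [h']
          rfl
        · simp only [σ, dif_neg h, if_neg h', Sum.elim_inl]
          rfl
  have hfam : (fun l => A (ρ l)) = fun l => (Sum.elim ![A s₀, A s₁] (fun c : Ic => A c.1) (σ (ρ l)) : AbelianVariety ℂ) := funext fun l => hσ (ρ l) (hρ l)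
  rw [hfam]
  exact hodgeConjectureFor_prod_two_simple_dim_le_two_anyCurves (kq := fun c : Ic => K c.1) (E := fun c : Ic => A c.1) (Ψ := fun c : Ic => Φ c.1)
    (ιE := fun c : Ic => ι c.1) (θE := fun c : Ic => θ c.1) hd₀ hd₁ (hA s₀) (hA s₁) (hS s₀) (hS s₁) (fun c => c.2) (fun c => hA c.1) fun l => σ (ρ l)

/-- **Products of copies of CM elliptic curves of the family** (isogenous or not) satisfy the Hodge conjecture, unconditionally (the empty product is zero-dimensional;
otherwise §1 with `s₀ = s₁ =` the first member). [cite: MoonenZarhin1999LowDim, §5 (5.2)] [cite: Gordon1999HodgeAVSurvey, 10.10] -/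
theorem hodgeConjectureFor_prod_curveSlots (hA : ∀ i, IsCMTypeRealisation (Φ i) (A i) (ι i) (θ i)) (hS : ∀ i, (A i).IsSimple) {M : ℕ} (ρ : Fin M → I)
    (hρ : ∀ l, Module.finrank ℚ (K (ρ l)) = 2) : HodgeConjectureFor (⨁ fun l => A (ρ l)).dim (⨁ fun l => A (ρ l)).X := by
  cases M with
  | zero => exact hodgeConjectureFor_biproduct_fin_zero₃₅ _
  | succ M => exact hodgeConjectureFor_prod_surfaceBlock hA hS (Or.inl (hρ 0)) (Or.inl (hρ 0)) ρ fun l => Or.inl (hρ l)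

/-- **The surface block, from «among any three quartic slots two coincide»**: a product of copies of members of dimension `≤ 3` meeting no sextic slot satisfies the Hodge
conjecture — UNCONDITIONALLY. [cite: MoonenZarhin1999LowDim, §3 (3.1), Cor. (3.9)] [cite: Gordon1999HodgeAVSurvey, 7.5 and 10.10] -/
theorem hodgeConjectureFor_prod_surfaceBlock_of_atMostTwo (hA : ∀ i, IsCMTypeRealisation (Φ i) (A i) (ι i) (θ i)) (hS : ∀ i, (A i).IsSimple)
    (h3 : ∀ i, (A i).dim ≤ 3) (hS2 : ∀ i j l : I, Module.finrank ℚ (K i) = 4 → Module.finrank ℚ (K j) = 4 → Module.finrank ℚ (K l) = 4 → i = j ∨ i = l ∨ j = l)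
    {M : ℕ} (ρ : Fin M → I) (hρ : ∀ l, Module.finrank ℚ (K (ρ l)) ≠ 6) : HodgeConjectureFor (⨁ fun l => A (ρ l)).dim (⨁ fun l => A (ρ l)).X := by
  by_cases hq : ∃ s, Module.finrank ℚ (K s) = 4
  · obtain ⟨s₀, hs₀⟩ := hq
    obtain ⟨s₁, hs₁, hcov⟩ : ∃ s₁, Module.finrank ℚ (K s₁) = 4 ∧ ∀ i, Module.finrank ℚ (K i) = 4 → i = s₀ ∨ i = s₁ := by
      by_cases hq' : ∃ s, Module.finrank ℚ (K s) = 4 ∧ s ≠ s₀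
      · obtain ⟨s₁, hs₁, hne⟩ := hq'
        refine ⟨s₁, hs₁, fun i hi => ?_⟩
        rcases hS2 s₀ s₁ i hs₀ hs₁ hi with h | h | h
        · exact absurd h.symm hne
        · exact Or.inl h.symm
        · exact Or.inr h.symm
      · exact ⟨s₀, hs₀, fun i hi => Or.inl (by by_contra h; exact hq' ⟨i, hi, h⟩)⟩
    refine hodgeConjectureFor_prod_surfaceBlock hA hS (Or.inr hs₀) (Or.inr hs₁) ρ fun l => ?_
    rcases finrank_eq_or_of_dim_le_three₃₅' hA (h3 (ρ l)) with h | h | h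
    · exact Or.inl h
    · exact Or.inr (hcov _ h)
    · exact absurd h (hρ l)
  · refine hodgeConjectureFor_prod_curveSlots hA hS ρ fun l => ?_
    rcases finrank_eq_or_of_dim_le_three₃₅' hA (h3 (ρ l)) with h | h | h
    · exact h
    · exact absurd ⟨ρ l, h⟩ hq
    · exact absurd h (hρ l)

/-! ## §2 The threefold block: at most two threefold slots and curves — Markman's fourfold theorem -/

/-- **THE THREEFOLD BLOCK.**  `A_i ⊨ (K_i; Φ_i)` simple; `t₀, t₁` slots with sextic fields (simple CM threefolds); a product of copies `⨁_l A_{ρ l}` every member of which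
is a CM elliptic curve or one of `A_{t₀}, A_{t₁}`.  Then the Hodge conjecture holds for it, GIVEN ONLY Markman's fourfold theorem — slot by slot it is a product of copies
of `Sum.elim ![A_{t₀}, A_{t₁}] (curves)`, and gen 34's roof «any two simple CM threefolds × any finite family of CM elliptic curves»
(`hodgeConjectureFor_prod_two_simpleThreefolds_anyCurves_of_markman`) applies. [cite: MoonenZarhin1999LowDim, Thm. (0.1), (0.2)] [cite: Markman2025SurveySecant, Thm. 1.2] -/
theorem hodgeConjectureFor_prod_threefoldBlock_of_markman (hW4 : Markman2025_weilClasses_algebraic_abelianFourfold)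
    (hA : ∀ i, IsCMTypeRealisation (Φ i) (A i) (ι i) (θ i)) (hS : ∀ i, (A i).IsSimple) {t₀ t₁ : I} (h6₀ : Module.finrank ℚ (K t₀) = 6)
    (h6₁ : Module.finrank ℚ (K t₁) = 6) {M : ℕ} (ρ : Fin M → I) (hρ : ∀ l, Module.finrank ℚ (K (ρ l)) = 2 ∨ ρ l = t₀ ∨ ρ l = t₁) :
    HodgeConjectureFor (⨁ fun l => A (ρ l)).dim (⨁ fun l => A (ρ l)).X := by
  -- the curve slots and the slot map onto `Fin 2 ⊕ Ic`
  let Ic : Type := {i : I // Module.finrank ℚ (K i) = 2}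
  let σ : I → Fin 2 ⊕ Ic := fun i => if h : Module.finrank ℚ (K i) = 2 then Sum.inr ⟨i, h⟩ else if i = t₀ then Sum.inl 0 else Sum.inl 1
  have hσ : ∀ i, (Module.finrank ℚ (K i) = 2 ∨ i = t₀ ∨ i = t₁) → A i = (Sum.elim ![A t₀, A t₁] (fun c : Ic => A c.1) (σ i) : AbelianVariety ℂ) := by
    intro i hi
    by_cases h : Module.finrank ℚ (K i) = 2
    · simp only [σ, dif_pos h, Sum.elim_inr]
    · rcases hi with h2 | rfl | rfl
      · exact absurd h2 h
      · simp only [σ, dif_neg h]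
        rfl
      · by_cases h' : i = t₀
        · simp only [σ, dif_neg h, if_pos h', Sum.elim_inl]
          rw [h']
          rfl
        · simp only [σ, dif_neg h, if_neg h', Sum.elim_inl]
          rfl
  have hfam : (fun l => A (ρ l)) = fun l => (Sum.elim ![A t₀, A t₁] (fun c : Ic => A c.1) (σ (ρ l)) : AbelianVariety ℂ) := funext fun l => hσ (ρ l) (hρ l)
  rw [hfam]
  exact hodgeConjectureFor_prod_two_simpleThreefolds_anyCurves_of_markman (kq := fun c : Ic => K c.1) (E := fun c : Ic => A c.1) (Ψ := fun c : Ic => Φ c.1)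
    (ιE := fun c : Ic => ι c.1) (θE := fun c : Ic => θ c.1) hW4 h6₀ h6₁ (hA t₀) (hA t₁) (hS t₀) (hS t₁) (fun c => c.2) (fun c => hA c.1) fun l => σ (ρ l)

/-- **The threefold block, from «among any three sextic slots two coincide»**: a product of copies of members of dimension `≤ 3` meeting no quartic slot satisfies the
Hodge conjecture, given only Markman's fourfold theorem (no sextic slot at all: curves only, §1). [cite: MoonenZarhin1999LowDim, Thm. (0.1), (0.2)]
[cite: Markman2025SurveySecant, Thm. 1.2] -/
theorem hodgeConjectureFor_prod_threefoldBlock_of_atMostTwo_of_markman (hW4 : Markman2025_weilClasses_algebraic_abelianFourfold)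
    (hA : ∀ i, IsCMTypeRealisation (Φ i) (A i) (ι i) (θ i)) (hS : ∀ i, (A i).IsSimple) (h3 : ∀ i, (A i).dim ≤ 3)
    (hT2 : ∀ i j l : I, Module.finrank ℚ (K i) = 6 → Module.finrank ℚ (K j) = 6 → Module.finrank ℚ (K l) = 6 → i = j ∨ i = l ∨ j = l) {M : ℕ} (ρ : Fin M → I)
    (hρ : ∀ l, Module.finrank ℚ (K (ρ l)) ≠ 4) : HodgeConjectureFor (⨁ fun l => A (ρ l)).dim (⨁ fun l => A (ρ l)).X := by
  by_cases hT : ∃ t, Module.finrank ℚ (K t) = 6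
  · obtain ⟨t₀, ht₀⟩ := hT
    obtain ⟨t₁, ht₁, hcov⟩ : ∃ t₁, Module.finrank ℚ (K t₁) = 6 ∧ ∀ i, Module.finrank ℚ (K i) = 6 → i = t₀ ∨ i = t₁ := by
      by_cases hT' : ∃ t, Module.finrank ℚ (K t) = 6 ∧ t ≠ t₀
      · obtain ⟨t₁, ht₁, hne⟩ := hT'
        refine ⟨t₁, ht₁, fun i hi => ?_⟩
        rcases hT2 t₀ t₁ i ht₀ ht₁ hi with h | h | h
        · exact absurd h.symm hne
        · exact Or.inl h.symm
        · exact Or.inr h.symm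
      · exact ⟨t₀, ht₀, fun i hi => Or.inl (by by_contra h; exact hT' ⟨i, hi, h⟩)⟩
    refine hodgeConjectureFor_prod_threefoldBlock_of_markman hW4 hA hS ht₀ ht₁ ρ fun l => ?_
    rcases finrank_eq_or_of_dim_le_three₃₅' hA (h3 (ρ l)) with h | h | h
    · exact Or.inl h
    · exact absurd h (hρ l)
    · exact Or.inr (hcov _ h)
  · refine hodgeConjectureFor_prod_curveSlots hA hS ρ fun l => ?_
    rcases finrank_eq_or_of_dim_le_three₃₅' hA (h3 (ρ l)) with h | h | h
    · exact h
    · exact absurd h (hρ l)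
    · exact absurd ⟨ρ l, h⟩ hT

/-! ## §3 At most two threefolds, at most two surfaces, any curves -/

/-- **MAIN THEOREM — AT MOST TWO THREEFOLD SLOTS, AT MOST TWO SURFACE SLOTS, ANY CURVES, given ONLY Markman's fourfold theorem.**  `A_i ⊨ (K_i; Φ_i)` (`i ∈ I`,
finite) SIMPLE complex abelian varieties of CM type of dimension `≤ 3`; among any three slots with sextic fields two coincide, and among any three slots with quartic fields
two coincide; any number of quadratic slots (CM elliptic curves, isogenous or not); nothing assumed on any field.  Then for every `π : Fin N → I` the Hodge conjecture
holds for `⨁_j A_{π j}` — every `T₀^a × T₁^b × S₀^c × S₁^d × ∏_e E_e^{n_e}` — GIVEN ONLY `Markman2025_weilClasses_algebraic_abelianFourfold`: the threefold block splits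
off the surface block (previous file, unconditional), the threefold block is §2 (Markman 4), the surface block is §1 (unconditional).  `HC_CM` is NOT asserted.
[cite: MoonenZarhin1999LowDim, Thm. (0.1), Thm. (0.2), §3 (3.1), Cor. (3.9), §5 (5.2)] [cite: Markman2025SurveySecant, Thm. 1.2] [cite: Gordon1999HodgeAVSurvey, §3 Theorem (proof), 7.4–7.7, 10.10] -/
theorem hodgeConjectureFor_prod_of_atMostTwo_threefolds_atMostTwo_surfaces_of_markman (hW4 : Markman2025_weilClasses_algebraic_abelianFourfold)
    (hA : ∀ i, IsCMTypeRealisation (Φ i) (A i) (ι i) (θ i)) (hS : ∀ i, (A i).IsSimple) (h3 : ∀ i, (A i).dim ≤ 3)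
    (hT2 : ∀ i j l : I, Module.finrank ℚ (K i) = 6 → Module.finrank ℚ (K j) = 6 → Module.finrank ℚ (K l) = 6 → i = j ∨ i = l ∨ j = l)
    (hS2 : ∀ i j l : I, Module.finrank ℚ (K i) = 4 → Module.finrank ℚ (K j) = 4 → Module.finrank ℚ (K l) = 4 → i = j ∨ i = l ∨ j = l) {N : ℕ} (π : Fin N → I) :
    HodgeConjectureFor (⨁ fun j => A (π j)).dim (⨁ fun j => A (π j)).X := by
  -- marked slots (field into a sextic member field) are not surfaces; unmarked ones are not threefolds
  have hp4 : ∀ i, (∃ t, Module.finrank ℚ (K t) = 6 ∧ Nonempty (K i →+* K t)) → Module.finrank ℚ (K i) ≠ 4 := by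
    rintro i ⟨t, ht, ⟨g⟩⟩ h4
    have h := finrank_dvd_of_ringHom₃₅' g
    rw [h4, ht] at h
    omega
  have hp6 : ∀ i, (¬ ∃ t, Module.finrank ℚ (K t) = 6 ∧ Nonempty (K i →+* K t)) → Module.finrank ℚ (K i) ≠ 6 := fun i hi h6 => hi ⟨i, h6, ⟨RingHom.id _⟩⟩
  by_cases hboth : (∃ i, ∃ t, Module.finrank ℚ (K t) = 6 ∧ Nonempty (K i →+* K t)) ∧ ∃ j, ¬ ∃ t, Module.finrank ℚ (K t) = 6 ∧ Nonempty (K j →+* K t)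
  · -- both blocks occur: split and glue
    exact hodgeConjectureFor_prod_of_threefoldBlock_surfaceBlock hA hS h3 (fun i => ∃ t, Module.finrank ℚ (K t) = 6 ∧ Nonempty (K i →+* K t)) (fun _ => Iff.rfl)
      hboth.1 hboth.2 (fun M ρ hρ => hodgeConjectureFor_prod_threefoldBlock_of_atMostTwo_of_markman hW4 hA hS h3 hT2 ρ fun l => hp4 _ (hρ l))
      (fun M ρ hρ => hodgeConjectureFor_prod_surfaceBlock_of_atMostTwo hA hS h3 hS2 ρ fun l => hp6 _ (hρ l)) π
  · rw [not_and_or, not_exists, not_exists] at hboth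
    rcases hboth with hnone | hall
    · -- no marked slot: the whole family is the surface block
      exact hodgeConjectureFor_prod_surfaceBlock_of_atMostTwo hA hS h3 hS2 π fun l => hp6 _ (hnone (π l))
    · -- every slot marked: the whole family is the threefold block
      exact hodgeConjectureFor_prod_threefoldBlock_of_atMostTwo_of_markman hW4 hA hS h3 hT2 π fun l => hp4 _ (not_not.1 (hall (π l)))

/-- **Dominated form**: everything dominated by a product of copies of such a family — everything isogenous to one, every abelian subvariety or quotient of one —
satisfies the Hodge conjecture, given only Markman's fourfold theorem. [cite: MoonenZarhin1999LowDim, Thm. (0.1), (0.2)] [cite: Markman2025SurveySecant, Thm. 1.2]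
[cite: MumfordAV1970, §19 Thm. 1 and p. 169] -/
theorem hodgeConjectureFor_of_avDominatedBy_prod_of_atMostTwo_threefolds_atMostTwo_surfaces_of_markman (hW4 : Markman2025_weilClasses_algebraic_abelianFourfold)
    (hA : ∀ i, IsCMTypeRealisation (Φ i) (A i) (ι i) (θ i)) (hS : ∀ i, (A i).IsSimple) (h3 : ∀ i, (A i).dim ≤ 3)
    (hT2 : ∀ i j l : I, Module.finrank ℚ (K i) = 6 → Module.finrank ℚ (K j) = 6 → Module.finrank ℚ (K l) = 6 → i = j ∨ i = l ∨ j = l)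
    (hS2 : ∀ i j l : I, Module.finrank ℚ (K i) = 4 → Module.finrank ℚ (K j) = 4 → Module.finrank ℚ (K l) = 4 → i = j ∨ i = l ∨ j = l) {N : ℕ} (π : Fin N → I)
    {X : AbelianVariety ℂ} (hX : Domination.AVDominatedBy X (⨁ fun j => A (π j))) : HodgeConjectureFor X.dim X.X :=
  Domination.hodgeConjectureFor_of_avDominatedBy (hodgeConjectureFor_prod_of_atMostTwo_threefolds_atMostTwo_surfaces_of_markman hW4 hA hS h3 hT2 hS2 π) hX

end Family

end Summit.HodgeConjecture.CorCM.MultiFieldWeil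

end
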